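import Summits.KontsevichZagierPeriods.KontsevichZagierPeriods.Theorems.SoloBlindBoxGenerators
import Mathlib.RingTheory.AlgebraicIndependent.Transcendental
import Mathlib.RingTheory.AlgebraicIndependent.AlgebraicClosure
import Mathlib.RingTheory.Adjoin.Polynomial.Basic
import Mathlib.LinearAlgebra.Finsupp.LinearCombination
import HarnessLib

/-!
# The box sector of the Kontsevich–Zagier conjecture, VI: the rank-one sector (unconditional)

**Theorem (rank-one box sector; unconditional).**  Let `ω` be a *one-dimensional rational
period*: the value of a rational integral representation of dimension `≤ 1` (equivalently, by the
dimension-`≤ 1` normal form, a `ℚ̄`-linear combination of `1`, logarithms `log μ` and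
arctangents `arctan t` of real algebraic numbers; e.g. `ω = π`, `ω = log 2`).  Let
`B(ω) ⊆ FormalRep` be the subring generated by the rational integral representations of dimension
`≤ 1` whose value lies on the line `ℚ̄ + ℚ̄·ω`.  Then every element of `B(ω)` with value `0` is a
consequence of the three Kontsevich–Zagier moves (`lineRing_kernel`), and two elements of `B(ω)`
with the same period — e.g. two Fubini products, of any length, of rational one-dimensional
integrals with values in `ℚ + ℚπ` — are equivalent under the moves (`kz_lineRing`,
`kz_lineRing_pi`, `kz_lineRing_log`, `kz_lineRing_arctan`, `kz_lineRing_period`).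

So *all polynomial identities among such integrals* (`π² = (4∫₀¹ dx/(1+x²))·(4∫₀¹ dx/(1+x²))`
against any other product with value `π²`, identities among powers of `log 2`, …) are accessible
by the moves, with no transcendence hypothesis: the proof uses Baker's theorem (through the
dimension-`≤ 1` injectivity theorem `SoloBlindDimLeOne`) and nothing else — the dichotomy
"`ω` algebraic or transcendental" replaces the conjectural algebraic independence of logarithms
needed for the full box ring (`SoloBlindBoxKernel`).

Structure of the proof, in the formal period ring `Q = FormalRep ⧸ relations`:
* the **cell span** `V ⊆ Q` — the `K₀`-submodule spanned by `1`, `ℓ(μ)` (`μ > 1`), `a(t)`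
  (`t > 0`) — contains the class of every rational representation of dimension `≤ 1`, and
  `evalQ` is injective on `V` (`eq_zero_of_mem_cellSpan`; this is the dimension-`≤ 1` theorem);
* for `x ∈ V`, `evalQ` is injective on the subalgebra `K₀[x]`
  (`mem_relations_of_mem_adjoin_singleton`): if `evalQ x` is algebraic then `x` is a scalar by
  injectivity on `V`; if it is transcendental, a polynomial relation `p(evalQ x) = 0` over `K₀`
  forces `p = 0`;
* the class of every generator of `B(ω)`, `ω = evalQ x`, lies in `K₀[x]` (injectivity on `V`
  again), hence so does the class of every element of `B(ω)`.

References: M. Kontsevich, D. Zagier, *Periods* (2001), §1.2; A. Baker, *Transcendental number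
theory* (1975), Theorem 2.1.
-/

noncomputable section

open scoped BigOperators

namespace Summit.KontsevichZagierPeriods.KontsevichZagierPeriods.Theorems

open Literature.NumberTheory.Transcendental
open Literature.NumberTheory.Transcendental.KZ

namespace SoloBlind

/-! ## The cell span `V ⊆ Q` -/

/-- The generators of the cell span: `1`, `ℓ(μ)` (`μ > 1` algebraic), `a(t)` (`t > 0` algebraic). -/
def cellGens : Set Q :=
  {1} ∪ ell '' {μ | IsAlgebraic ℚ μ ∧ 1 < μ} ∪ alpha '' {t | IsAlgebraic ℚ t ∧ 0 < t}

/-- The **cell span** `V`: the `K₀`-submodule of `Q` spanned by the unit cells. -/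
def cellSpan : Submodule K₀ Q := Submodule.span K₀ cellGens

/-- `1 ∈ V`. -/
theorem one_mem_cellSpan : (1 : Q) ∈ cellSpan :=
  Submodule.subset_span (Or.inl (Or.inl rfl))

/-- `κ(β) ∈ V`. -/
theorem kappa_mem_cellSpan (β : K₀) : kappa β ∈ cellSpan := by
  rw [← mul_one (kappa β), ← smul_eq_kappa_mul]
  exact Submodule.smul_mem _ β one_mem_cellSpan

/-- `ℓ(μ) ∈ V` for algebraic `μ > 1`. -/
theorem ell_mem_cellSpan {μ : ℝ} (hμ : IsAlgebraic ℚ μ) (h1 : 1 < μ) : ell μ ∈ cellSpan :=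
  Submodule.subset_span (Or.inl (Or.inr ⟨μ, ⟨hμ, h1⟩, rfl⟩))

/-- `a(t) ∈ V` for algebraic `t > 0`. -/
theorem alpha_mem_cellSpan {t : ℝ} (ht : IsAlgebraic ℚ t) (h0 : 0 < t) : alpha t ∈ cellSpan :=
  Submodule.subset_span (Or.inr ⟨t, ⟨ht, h0⟩, rfl⟩)

/-- The class of a cell sum lies in `V`. -/
theorem mkQ_mem_cellSpan_of_isCellSum {z : FormalRep} (hz : IsCellSum z) : mkQ z ∈ cellSpan := by
  classical
  obtain ⟨ιL, ιA, _, _, α, hα, c, l, hc, hl, d, τ, hd, hτ, h1, h0, hrel⟩ := hz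
  rw [mkQ_eq_mkQ_iff.mpr hrel, cellSum, map_add, map_add, map_sum, map_sum, mkQ_constCell]
  refine add_mem (add_mem (Submodule.smul_mem _ _ one_mem_cellSpan)
    (Submodule.sum_mem _ fun i _ => ?_)) (Submodule.sum_mem _ fun k _ => ?_)
  · rw [mkQ_logCell (hc i) (hl i)]
    exact Submodule.smul_mem _ _ (ell_mem_cellSpan (hl i) (h1 i))
  · rw [mkQ_atanCell (hd k) (hτ k)]
    exact Submodule.smul_mem _ _ (alpha_mem_cellSpan (hτ k) (h0 k))

/-- **The class of every rational representation of dimension `≤ 1` lies in `V`.** -/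
theorem mkQ_of_mem_cellSpan {n : ℕ} (r : IntegralRep n) (hn : n ≤ 1) (hr : r.IsRational) :
    mkQ (of r) ∈ cellSpan :=
  mkQ_mem_cellSpan_of_isCellSum (isCellSum_of_isRational_of_le_one r hn hr)

/-- A scalar multiple of a generator of `V` is the class of a cell. -/
theorem exists_isCellSum_smul_of_mem_cellGens {g : Q} (hg : g ∈ cellGens) (β : K₀) :
    ∃ w, IsCellSum w ∧ mkQ w = β • g := by
  rcases hg with (hg | ⟨μ, ⟨hμ, h1⟩, rfl⟩) | ⟨t, ⟨ht, h0⟩, rfl⟩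
  · rw [Set.mem_singleton_iff] at hg
    subst hg
    exact ⟨_, isCellSum_constCell (β : ℝ) (K₀.isAlgebraic β), by
      simpa only [Subtype.coe_eta] using mkQ_constCell (β : ℝ) (K₀.isAlgebraic β)⟩
  · exact ⟨_, isCellSum_logCell (β : ℝ) μ (K₀.isAlgebraic β) hμ h1.le, by
      simpa only [Subtype.coe_eta] using mkQ_logCell (K₀.isAlgebraic β) hμ⟩
  · exact ⟨_, isCellSum_atanCell (β : ℝ) t (K₀.isAlgebraic β) ht h0.le, by
      simpa only [Subtype.coe_eta] using mkQ_atanCell (K₀.isAlgebraic β) ht⟩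

/-- Every element of `V` is the class of a cell sum. -/
theorem exists_isCellSum_of_mem_cellSpan {y : Q} (hy : y ∈ cellSpan) :
    ∃ w, IsCellSum w ∧ mkQ w = y := by
  obtain ⟨n, f, g, hsum⟩ := Submodule.mem_span_set'.mp hy
  choose w hw hwg using fun i => exists_isCellSum_smul_of_mem_cellGens (g i).2 (f i)
  refine ⟨∑ i, w i, IsCellSum.sum Finset.univ w (fun i _ => hw i), ?_⟩
  rw [map_sum, ← hsum]
  exact Finset.sum_congr rfl fun i _ => hwg i

/-- **`evalQ` is injective on the cell span** — the dimension-`≤ 1` theorem (Baker) read in `Q`. -/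
theorem eq_zero_of_mem_cellSpan {y : Q} (hy : y ∈ cellSpan) (h0 : evalQ y = 0) : y = 0 := by
  obtain ⟨w, hw, rfl⟩ := exists_isCellSum_of_mem_cellSpan hy
  rw [evalQ_mkQ] at h0
  exact mkQ_eq_zero_iff.mpr (mem_relations_of_isCellSum_of_eval_eq_zero hw h0)

/-- `evalQ (β • y) = β · evalQ y`. -/
theorem evalQ_smul (β : K₀) (y : Q) : evalQ (β • y) = (β : ℝ) * evalQ y := by
  rw [smul_eq_kappa_mul, map_mul, evalQ_kappa]

/-! ## Transcendence over `K₀` -/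

/-- A real number transcendental over `ℚ` is transcendental over the field `K₀` of real algebraic
numbers. -/
theorem transcendental_K₀ {x : ℝ} (hx : Transcendental ℚ x) : Transcendental K₀ x :=
  algebraicIndependent_iff_transcendental.mp
    (algebraicIndependent_iff_transcendental.mpr hx).algebraicClosure

/-! ## The rank-one kernel theorem in `Q` -/

/-- An element of `V` with algebraic value is a scalar. -/
theorem eq_kappa_of_mem_cellSpan {x : Q} (hx : x ∈ cellSpan) (halg : IsAlgebraic ℚ (evalQ x)) :
    x = kappa ⟨evalQ x, mem_K₀_iff.mpr halg⟩ := by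
  rw [← sub_eq_zero]
  apply eq_zero_of_mem_cellSpan (sub_mem hx (kappa_mem_cellSpan _))
  rw [map_sub, evalQ_kappa]
  exact sub_eq_zero.mpr rfl

/-- **`evalQ` is injective on `K₀[x]` for every `x` in the cell span** (unconditional).  If
`evalQ x` is algebraic, `x` is a scalar and `K₀[x] = K₀`; if it is transcendental, a relation
`p(evalQ x) = 0` with `p ∈ K₀[X]` forces `p = 0`. -/
theorem mem_relations_of_mem_adjoin_singleton {x : Q} (hx : x ∈ cellSpan) {z : FormalRep}
    (hz : mkQ z ∈ Algebra.adjoin K₀ {x}) (h0 : eval z = 0) : z ∈ relations := by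
  rw [← mkQ_eq_zero_iff]
  by_cases halg : IsAlgebraic ℚ (evalQ x)
  · -- `x` is the scalar `evalQ x`
    have hxα := eq_kappa_of_mem_cellSpan hx halg
    have hbot : mkQ z ∈ (⊥ : Subalgebra K₀ Q) := by
      refine (Algebra.adjoin_le ?_ : Algebra.adjoin K₀ {x} ≤ ⊥) hz
      intro y hy
      rw [Set.mem_singleton_iff] at hy
      rw [hy, hxα, ← algebraMap_eq_kappa]
      exact Subalgebra.algebraMap_mem _ _
    obtain ⟨c, hc⟩ := Algebra.mem_bot.mp hbot
    have hc0 : (c : ℝ) = 0 := by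
      have h1 := congrArg evalQ hc
      rwa [algebraMap_eq_kappa, evalQ_kappa, evalQ_mkQ, h0] at h1
    have hc0' : c = 0 := by exact_mod_cast hc0
    rw [← hc, hc0', map_zero]
  · -- `evalQ x` is transcendental over `K₀`
    have ht : Transcendental K₀ (evalQ x) := transcendental_K₀ halg
    rw [Algebra.adjoin_singleton_eq_range_aeval, AlgHom.mem_range] at hz
    obtain ⟨p, hp⟩ := hz
    have hp0 : Polynomial.aeval (evalQ x) p = 0 := by
      have h1 := congrArg evalAlgHom hp
      rw [← Polynomial.aeval_algHom_apply, evalAlgHom_mkQ, h0, evalAlgHom_apply] at h1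
      exact h1
    have hp' : p = 0 := (transcendental_iff_injective.mp ht) (by rw [hp0, map_zero])
    rw [← hp, hp', map_zero]

/-! ## The rank-one rings `B(ω)` -/

/-- The generators of `B(ω)`: rational representations of dimension `≤ 1` with value on the line
`ℚ̄ + ℚ̄·ω`. -/
def lineGens (ω : ℝ) : Set FormalRep :=
  {x | ∃ (n : ℕ) (r : IntegralRep n), n ≤ 1 ∧ r.IsRational ∧
    (∃ β γ : ℝ, IsAlgebraic ℚ β ∧ IsAlgebraic ℚ γ ∧ r.value = β + γ * ω) ∧ x = of r}

/-- The **rank-one ring** `B(ω)`: the subring of `FormalRep` generated by `lineGens ω`. -/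
def lineRing (ω : ℝ) : NonUnitalSubring FormalRep :=
  NonUnitalSubring.closure (lineGens ω)

/-- A rational representation of dimension `≤ 1` with value `β + γ·ω` (`β, γ` algebraic) lies in
`B(ω)`. -/
theorem of_mem_lineRing {ω : ℝ} {n : ℕ} (r : IntegralRep n) (hn : n ≤ 1) (hr : r.IsRational)
    {β γ : ℝ} (hβ : IsAlgebraic ℚ β) (hγ : IsAlgebraic ℚ γ) (hv : r.value = β + γ * ω) :
    of r ∈ lineRing ω :=
  NonUnitalSubring.subset_closure ⟨n, r, hn, hr, ⟨β, γ, hβ, hγ, hv⟩, rfl⟩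

/-- `B(ω)` is closed under products. -/
theorem mul_mem_lineRing {ω : ℝ} {a b : FormalRep} (ha : a ∈ lineRing ω) (hb : b ∈ lineRing ω) :
    a * b ∈ lineRing ω :=
  mul_mem ha hb

/-- If `ω = evalQ x` with `x ∈ V`, the class of every generator of `B(ω)` lies in `K₀[x]`
(injectivity of `evalQ` on `V`). -/
theorem mkQ_mem_adjoin_of_mem_lineGens {x : Q} (hx : x ∈ cellSpan) {g : FormalRep}
    (hg : g ∈ lineGens (evalQ x)) : mkQ g ∈ Algebra.adjoin K₀ {x} := by
  obtain ⟨n, r, hn, hr, ⟨β, γ, hβ, hγ, hv⟩, rfl⟩ := hg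
  have heq : mkQ (of r) =
      (⟨β, mem_K₀_iff.mpr hβ⟩ : K₀) • (1 : Q) + (⟨γ, mem_K₀_iff.mpr hγ⟩ : K₀) • x := by
    rw [← sub_eq_zero]
    apply eq_zero_of_mem_cellSpan
    · exact sub_mem (mkQ_of_mem_cellSpan r hn hr) (add_mem
        (Submodule.smul_mem _ _ one_mem_cellSpan) (Submodule.smul_mem _ _ hx))
    · rw [map_sub, map_add, evalQ_smul, evalQ_smul, map_one, mul_one, evalQ_mkQ, eval_of, hv]
      exact sub_eq_zero.mpr rfl
  rw [heq]
  exact add_mem (Subalgebra.smul_mem _ (one_mem _) _)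
    (Subalgebra.smul_mem _ (Algebra.subset_adjoin (Set.mem_singleton x)) _)

/-- Closure induction: if the classes of the generators lie in a `K₀`-subalgebra of `Q`, so does
the class of every element of the generated subring. -/
theorem mkQ_mem_of_mem_closure {S : Set FormalRep} {A : Subalgebra K₀ Q}
    (hS : ∀ g ∈ S, mkQ g ∈ A) {z : FormalRep} (hz : z ∈ NonUnitalSubring.closure S) :
    mkQ z ∈ A := by
  induction hz using NonUnitalSubring.closure_induction with
  | mem x hx => exact hS x hx
  | zero => rw [map_zero]; exact zero_mem _
  | add x y _ _ hx hy => rw [map_add]; exact add_mem hx hy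
  | neg x _ hx => rw [map_neg]; exact neg_mem hx
  | mul x y _ _ hx hy => rw [mkQ_mul]; exact mul_mem hx hy

/-- **The rank-one kernel theorem (unconditional).**  If `ω = evalQ x` for some `x` in the cell
span, every element of `B(ω)` with value `0` is a consequence of the Kontsevich–Zagier moves. -/
theorem lineRing_kernel {x : Q} (hx : x ∈ cellSpan) {z : FormalRep}
    (hz : z ∈ lineRing (evalQ x)) (h0 : eval z = 0) : z ∈ relations :=
  mem_relations_of_mem_adjoin_singleton hx
    (mkQ_mem_of_mem_closure (fun _ hg => mkQ_mem_adjoin_of_mem_lineGens hx hg) hz) h0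

/-- **The Kontsevich–Zagier conjecture on `B(ω)` (unconditional).**  If `ω = evalQ x` for some
`x` in the cell span, two integral representations in `B(ω)` with the same period are equivalent
under the Kontsevich–Zagier moves. -/
theorem kz_lineRing {x : Q} (hx : x ∈ cellSpan) {n m : ℕ} (r : IntegralRep n)
    (r' : IntegralRep m) (hr : of r ∈ lineRing (evalQ x)) (hr' : of r' ∈ lineRing (evalQ x))
    (hv : r.value = r'.value) : Equivalent r r' :=
  lineRing_kernel hx (sub_mem hr hr') (by rw [map_sub, eval_of, eval_of, hv, sub_self])

/-! ## Instances: `ω` a rational one-dimensional period, `π`, `log μ`, `arctan t` -/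

/-- **`ω` = any rational one-dimensional period.**  For a rational representation `r₀` of
dimension `≤ 1`, the Kontsevich–Zagier conjecture holds on `B(r₀.value)`. -/
theorem kz_lineRing_period {n₀ : ℕ} (r₀ : IntegralRep n₀) (hn₀ : n₀ ≤ 1) (hr₀ : r₀.IsRational)
    {n m : ℕ} (r : IntegralRep n) (r' : IntegralRep m) (hr : of r ∈ lineRing r₀.value)
    (hr' : of r' ∈ lineRing r₀.value) (hv : r.value = r'.value) : Equivalent r r' := by
  have hω : evalQ (mkQ (of r₀)) = r₀.value := by rw [evalQ_mkQ, eval_of]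
  rw [← hω] at hr hr'
  exact kz_lineRing (mkQ_of_mem_cellSpan r₀ hn₀ hr₀) r r' hr hr' hv

/-- The kernel form of `kz_lineRing_period`. -/
theorem lineRing_kernel_period {n₀ : ℕ} (r₀ : IntegralRep n₀) (hn₀ : n₀ ≤ 1)
    (hr₀ : r₀.IsRational) {z : FormalRep} (hz : z ∈ lineRing r₀.value) (h0 : eval z = 0) :
    z ∈ relations := by
  have hω : evalQ (mkQ (of r₀)) = r₀.value := by rw [evalQ_mkQ, eval_of]
  rw [← hω] at hz
  exact lineRing_kernel (mkQ_of_mem_cellSpan r₀ hn₀ hr₀) hz h0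

/-- `π = evalQ (4 • a(1))`. -/
theorem evalQ_four_smul_alpha_one : evalQ ((4 : K₀) • alpha 1) = Real.pi := by
  rw [evalQ_smul, evalQ_alpha isAlgebraic_one zero_le_one, Real.arctan_one]
  have h4 : ((4 : K₀) : ℝ) = 4 := by norm_cast
  rw [h4]
  ring

/-- **`ω = π`.**  The Kontsevich–Zagier conjecture holds on the ring generated by the rational
representations of dimension `≤ 1` with value in `ℚ̄ + ℚ̄π` — in particular for all products, of
any length, of such integrals (polynomial identities in `π`). -/
theorem kz_lineRing_pi {n m : ℕ} (r : IntegralRep n) (r' : IntegralRep m)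
    (hr : of r ∈ lineRing Real.pi) (hr' : of r' ∈ lineRing Real.pi) (hv : r.value = r'.value) :
    Equivalent r r' := by
  rw [← evalQ_four_smul_alpha_one] at hr hr'
  exact kz_lineRing (Submodule.smul_mem _ _ (alpha_mem_cellSpan isAlgebraic_one one_pos))
    r r' hr hr' hv

/-- The kernel form of `kz_lineRing_pi`. -/
theorem lineRing_kernel_pi {z : FormalRep} (hz : z ∈ lineRing Real.pi) (h0 : eval z = 0) :
    z ∈ relations := by
  rw [← evalQ_four_smul_alpha_one] at hz
  exact lineRing_kernel (Submodule.smul_mem _ _ (alpha_mem_cellSpan isAlgebraic_one one_pos))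
    hz h0

/-- **`ω = log μ`** (`μ > 1` real algebraic).  The Kontsevich–Zagier conjecture holds on the ring
generated by the rational representations of dimension `≤ 1` with value in `ℚ̄ + ℚ̄ log μ`. -/
theorem kz_lineRing_log {μ : ℝ} (hμ : IsAlgebraic ℚ μ) (h1 : 1 < μ) {n m : ℕ} (r : IntegralRep n)
    (r' : IntegralRep m) (hr : of r ∈ lineRing (Real.log μ))
    (hr' : of r' ∈ lineRing (Real.log μ)) (hv : r.value = r'.value) : Equivalent r r' := by
  rw [← evalQ_ell hμ h1.le] at hr hr'
  exact kz_lineRing (ell_mem_cellSpan hμ h1) r r' hr hr' hv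

/-- **`ω = arctan t`** (`t > 0` real algebraic).  The Kontsevich–Zagier conjecture holds on the
ring generated by the rational representations of dimension `≤ 1` with value in
`ℚ̄ + ℚ̄ arctan t`. -/
theorem kz_lineRing_arctan {t : ℝ} (ht : IsAlgebraic ℚ t) (h0 : 0 < t) {n m : ℕ}
    (r : IntegralRep n) (r' : IntegralRep m) (hr : of r ∈ lineRing (Real.arctan t))
    (hr' : of r' ∈ lineRing (Real.arctan t)) (hv : r.value = r'.value) : Equivalent r r' := by
  rw [← evalQ_alpha ht h0.le] at hr hr'
  exact kz_lineRing (alpha_mem_cellSpan ht h0) r r' hr hr' hv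

/-- **Products, `ω = π`.**  If `r₁, r₂, s₁, s₂` are rational representations of dimension `≤ 1`
with values in `ℚ̄ + ℚ̄π` and `r₁.value · r₂.value = s₁.value · s₂.value`, then the Fubini
products `r₁ × r₂` and `s₁ × s₂` are equivalent under the Kontsevich–Zagier moves. -/
theorem kz_prod_prod_pi {n₁ n₂ m₁ m₂ : ℕ} (r₁ : IntegralRep n₁) (r₂ : IntegralRep n₂)
    (s₁ : IntegralRep m₁) (s₂ : IntegralRep m₂)
    (hr₁ : of r₁ ∈ lineRing Real.pi) (hr₂ : of r₂ ∈ lineRing Real.pi)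
    (hs₁ : of s₁ ∈ lineRing Real.pi) (hs₂ : of s₂ ∈ lineRing Real.pi)
    (hv : r₁.value * r₂.value = s₁.value * s₂.value) :
    Equivalent (r₁.prod r₂) (s₁.prod s₂) :=
  kz_lineRing_pi _ _ (by rw [← of_mul_of]; exact mul_mem hr₁ hr₂)
    (by rw [← of_mul_of]; exact mul_mem hs₁ hs₂)
    (by rw [IntegralRep.value_prod, IntegralRep.value_prod, hv])

end SoloBlind

end Summit.KontsevichZagierPeriods.KontsevichZagierPeriods.Theorems
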